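import Literature.Computability.AlgebraicComplexity.AndrewsForbes2022PfaffianReductionProofs
import Literature.Computability.AlgebraicComplexity.AndrewsForbes2022Prop35AllFields

/-!
# Andrews–Forbes 2022, Prop. 4.2 over every field; Thm. 4.4 in all characteristics

* `AndrewsForbes2022_prop_4_2_of_field` — the conclusion of the named fact
  `AndrewsForbes2022_prop_4_2` (AF22 Prop. 4.2, p0026:L23) for EVERY field (finite fields included):
  the infinite-field theorem `AndrewsForbes2022_prop_4_2_of_infinite`
  (`AndrewsForbes2022PfaffianReductionProofs.lean`) over `F(t)`, specialised along `t ↦ ε`,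
  `E ↦ ε^M`, `M ≫ 0`, exactly as `AndrewsForbes2022_prop_3_5_of_field`
  (`AndrewsForbes2022Prop35AllFields.lean`, whose `regularSubring` / valuation toolkit is reused;
  the leading-coefficient approximation is AF22 Lemma 2.39, p0018:L23).
* `AndrewsForbes2022_thm_4_4_holds : AndrewsForbes2022_thm_4_4` — DISCHARGE of the named fact
  (AF22 Thm. 4.4, characteristic zero): the tree's `AndrewsForbes2022_thm_4_4_of_prop_4_2` fed with
  `AndrewsForbes2022_prop_4_2_holds`.
* `AndrewsForbes2022_thm_4_4_posChar_holds : AndrewsForbes2022_thm_4_4_posChar` — DISCHARGE of the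
  positive-characteristic bullet: the tree's `AndrewsForbes2022_thm_4_4_posChar_of`
  (`AndrewsForbes2022PosCharReductions.lean`) fed with `AndrewsForbes2022_prop_4_2_of_field`.

No new definitions of mathematical notions, no new named facts (net debt `−2`).  Honest framing:
discharges of typed literature statements; VP ≠ VNP is NOT proved and nothing here is progress on it.

## References
* [AndrewsForbes2022] R. Andrews, M. A. Forbes, *Ideals, determinants, and straightening*,
  STOC 2022, arXiv:2112.00792 — Prop. 4.2 (p0026:L23), Thm. 4.4 (p0027:L85–L97),
  Lemmas 2.38–2.39 (p0017:L56–p0018:L45).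
-/

noncomputable section

open Polynomial WithZero Filter
open scoped RatFunc

namespace Literature.Computability.AlgebraicComplexity

namespace Prop42AllFields

open Matrix AndrewsForbes Theorem44

/-- Pfaffian ideals are defined over `ℤ`: extension of scalars maps `I^Pf_{2n,2r}` into itself.
[cite: AndrewsForbes2022, §2.6] -/
theorem map_mem_pfaffIdeal' {F L : Type*} [Field F] [Field L] (φ : F →+* L) {n r : ℕ}
    {f : MvPolynomial (SkewVarIdx (2 * n)) F} (hf : f ∈ pfaffIdeal F n r) :
    MvPolynomial.map φ f ∈ pfaffIdeal L n r := by
  have h := Ideal.mem_map_of_mem (MvPolynomial.map φ) hf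
  rw [pfaffIdeal, Ideal.map_span] at h
  refine (Ideal.span_le.2 ?_) h
  rintro _ ⟨p, ⟨ρ, rfl⟩, rfl⟩
  refine Ideal.subset_span ⟨ρ, ?_⟩
  change MvPolynomial.map φ _ = _
  rw [← PfaffianReduction.pfaffian_map' (MvPolynomial.map φ), ← Matrix.submatrix_map, skewX_map]

/-- The entries of `Q X Qᵀ` (the substitution underlying `skewCongr Q`). (proof plumbing)
[cite: AndrewsForbes2022, Prop. 4.2 (proof, last paragraph)] -/
def congrEntries {S : Type*} [CommRing S] {N : ℕ} (Q : Matrix (Fin N) (Fin N) S) :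
    SkewVarIdx N → MvPolynomial (SkewVarIdx N) S := fun ij =>
  ((Q.map MvPolynomial.C : Matrix (Fin N) (Fin N) (MvPolynomial (SkewVarIdx N) S)) * skewX S N *
    (Q.map MvPolynomial.C : Matrix (Fin N) (Fin N) (MvPolynomial (SkewVarIdx N) S))ᵀ) ij.1.1 ij.1.2

/-- `skewCongr Q p = bind₁ (congrEntries Q) (p ⊗ S)`. (proof plumbing) [cite: AndrewsForbes2022, Prop. 4.2 (proof)] -/
theorem skewCongr_eq_bind₁ {F S : Type*} [Field F] [CommRing S] [Algebra F S] {N : ℕ}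
    (Q : Matrix (Fin N) (Fin N) S) (p : MvPolynomial (SkewVarIdx N) F) :
    skewCongr Q p = MvPolynomial.bind₁ (congrEntries Q) (MvPolynomial.map (algebraMap F S) p) :=
  Prop35AllFields.aeval_eq_bind₁_map _ _

/-- `congrEntries` commutes with maps of scalars. (proof plumbing) [cite: AndrewsForbes2022, Prop. 4.2 (proof)] -/
theorem map_congrEntries {S T : Type*} [CommRing S] [CommRing T] {N : ℕ} (ψ : S →+* T)
    (Q : Matrix (Fin N) (Fin N) S) (ij : SkewVarIdx N) :
    MvPolynomial.map ψ (congrEntries Q ij) = congrEntries (Q.map ψ) ij := by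
  have hQ : (Q.map MvPolynomial.C : Matrix (Fin N) (Fin N) (MvPolynomial (SkewVarIdx N) S)).map
      (MvPolynomial.map ψ) = (Q.map ψ).map MvPolynomial.C := by
    rw [Matrix.map_map, Matrix.map_map]
    exact Matrix.ext fun i j => MvPolynomial.map_C _ _
  have hmat : ((Q.map MvPolynomial.C : Matrix (Fin N) (Fin N) (MvPolynomial (SkewVarIdx N) S)) * skewX S N *
      (Q.map MvPolynomial.C : Matrix (Fin N) (Fin N) (MvPolynomial (SkewVarIdx N) S))ᵀ).map
        (MvPolynomial.map ψ) =
      ((Q.map ψ).map MvPolynomial.C : Matrix (Fin N) (Fin N) (MvPolynomial (SkewVarIdx N) T)) * skewX T N *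
        ((Q.map ψ).map MvPolynomial.C : Matrix (Fin N) (Fin N) (MvPolynomial (SkewVarIdx N) T))ᵀ := by
    rw [Matrix.map_mul, Matrix.map_mul, Matrix.transpose_map, hQ, skewX_map]
  have := congrArg (fun M : Matrix (Fin N) (Fin N) (MvPolynomial (SkewVarIdx N) T) => M ij.1.1 ij.1.2) hmat
  simp only [Matrix.map_apply] at this
  exact this

end Prop42AllFields

/-! ### Proposition 4.2 over every field -/

set_option maxHeartbeats 800000 in
open Prop35AllFields Prop42AllFields AndrewsForbes Theorem44 in
/-- **Andrews–Forbes 2022, Proposition 4.2, over EVERY field** (all characteristics, finite fields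
included): for `1 ≤ r ≤ n` and a nonzero `f ∈ I^Pf_{2n,2r} ⊆ F[X]` there are an invertible `P` over
`F(ε)`, `q ∈ ℤ`, `α ∈ F^×` and a shape `σ` (even positive parts `≤ 2n`, `σ₁ ≥ 2r`) with
`f(P X Pᵀ) = ε^q α [K_σ](X) + O(ε^{q+1})` — the conclusion of `AndrewsForbes2022_prop_4_2` without
`[CharZero F]`.  Proof: `AndrewsForbes2022_prop_4_2_of_infinite` over the infinite field `F(t)`,
specialised along `t ↦ ε`, `E ↦ ε^M`, `M ≫ 0` (Lemma 2.39), verbatim as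
`AndrewsForbes2022_prop_3_5_of_field`. [cite: AndrewsForbes2022, Prop. 4.2] -/
theorem AndrewsForbes2022_prop_4_2_of_field (F : Type) [Field F] (n r : ℕ) (hr : 0 < r) (hrn : r ≤ n)
    (f : MvPolynomial (SkewVarIdx (2 * n)) F) (hf : f ∈ pfaffIdeal F n r) (hf0 : f ≠ 0) :
    ∃ (P : Matrix (Fin (2 * n)) (Fin (2 * n)) (RatFunc F)) (q : ℤ) (α : F) (σ : Multiset ℕ),
      IsUnit P ∧ α ≠ 0 ∧ 2 * r ≤ σ.sup ∧ (∀ s ∈ σ, Even s ∧ 0 < s ∧ s ≤ 2 * n) ∧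
      ∀ e : SkewVarIdx (2 * n) →₀ ℕ,
        IsBigOEps F (q + 1) (MvPolynomial.coeff e
          (skewCongr P f -
            MvPolynomial.C (RatFunc.X ^ q * algebraMap F (RatFunc F) α) *
              MvPolynomial.map (algebraMap F (RatFunc F)) (kPfaffMonomial F (2 * n) σ))) := by
  classical
  -- ### Step A: base change to the infinite field `L = F(t)` and Prop. 4.2 there
  haveI : Infinite (RatFunc F) :=
    Infinite.of_injective (algebraMap F[X] (RatFunc F)) (IsFractionRing.injective _ _)
  have hfL0 : MvPolynomial.map (algebraMap F (RatFunc F)) f ≠ 0 := fun h =>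
    hf0 (MvPolynomial.map_injective _ (algebraMap F (RatFunc F)).injective
      (by rw [h, map_zero]))
  obtain ⟨c, q, α, σ, hcU, hα, hσr, hσb, hbig⟩ :=
    AndrewsForbes2022_prop_4_2_of_infinite (RatFunc F) n r hr hrn
      (MvPolynomial.map (algebraMap F (RatFunc F)) f) (map_mem_pfaffIdeal' _ hf) hfL0
  -- notation: `L = F(ε)`, `RL = L(E)`
  set Δ : MvPolynomial (SkewVarIdx (2 * n)) (RatFunc (RatFunc F)) :=
    skewCongr c (MvPolynomial.map (algebraMap F (RatFunc F)) f) -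
      MvPolynomial.C (RatFunc.X ^ q * algebraMap (RatFunc F) (RatFunc (RatFunc F)) α) *
        MvPolynomial.map (algebraMap (RatFunc F) (RatFunc (RatFunc F)))
          (kPfaffMonomial (RatFunc F) (2 * n) σ) with hΔdef
  -- the leading `ε`-coefficient of `α ∈ F(ε)^×`
  obtain ⟨κ, α', hα', hαv⟩ := exists_leading_coeff α hα
  have hdet0 : c.det ≠ 0 := ((Matrix.isUnit_iff_isUnit_det c).mp hcU).ne_zero
  -- ### Step B: `M ≫ 0`
  have hA : ∀ᶠ M : ℕ in atTop, ∀ p : Fin (2 * n) × Fin (2 * n),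
      Polynomial.eval₂ (RingHom.id (RatFunc F)) ((RatFunc.X : RatFunc F) ^ M)
        (RatFunc.denom (c p.1 p.2)) ≠ 0 := by
    refine eventually_all.mpr fun p => ?_
    by_cases h0 : c p.1 p.2 = 0
    · refine Eventually.of_forall fun M => ?_
      rw [h0, RatFunc.denom_zero]; simp
    · exact (eventually_regular_and_v_eval _ h0).mono fun M hM => hM.1
  have hB : ∀ᶠ M : ℕ in atTop,
      RatFunc.eval (RingHom.id (RatFunc F)) ((RatFunc.X : RatFunc F) ^ M) c.det ≠ 0 :=
    (eventually_regular_and_v_eval _ hdet0).mono fun M hM => by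
      rw [← (Valuation.ne_zero_iff Valued.v), hM.2]
      exact mul_ne_zero (gam_ne_zero hdet0) exp_ne_zero
  have hC : ∀ᶠ M : ℕ in atTop, ∀ e ∈ Δ.support,
      Valued.v (RatFunc.eval (RingHom.id (RatFunc F)) ((RatFunc.X : RatFunc F) ^ M) (MvPolynomial.coeff e Δ)) =
        gam (MvPolynomial.coeff e Δ) * exp (-(ordE (MvPolynomial.coeff e Δ) * M)) :=
    (eventually_all_finset _).mpr fun e he =>
      (eventually_regular_and_v_eval _ (MvPolynomial.mem_support_iff.mp he)).mono fun M hM => hM.2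
  have hD : ∀ᶠ M : ℕ in atTop, ∀ e ∈ Δ.support, log (gam (MvPolynomial.coeff e Δ)) + κ + 1 ≤ (M : ℤ) :=
    (eventually_all_finset _).mpr fun e _ =>
      tendsto_natCast_atTop_atTop.eventually (eventually_ge_atTop _)
  obtain ⟨M, hMA, hMB, hMC, hMD⟩ := (hA.and (hB.and (hC.and hD))).exists
  -- ### Step C: the specialisation `E ↦ ε^M` on the functions regular there
  set a : RatFunc F := (RatFunc.X : RatFunc F) ^ M with hadef
  have ha0 : a ≠ 0 := pow_ne_zero _ RatFunc.X_ne_zero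
  let R := regularSubring a
  let π : R →+* RatFunc F := evalHom a
  let j : RatFunc F →+* R := constHom a
  have hπj : ∀ x, π (j x) = x := fun x => by
    change ((evalHom a).comp (constHom a)) x = x
    rw [evalHom_comp_constHom]; rfl
  let cR : Matrix (Fin (2 * n)) (Fin (2 * n)) R := fun i k => ⟨c i k, hMA (i, k)⟩
  have hcR : cR.map R.subtype = c := by ext i k; rfl
  let c' : Matrix (Fin (2 * n)) (Fin (2 * n)) (RatFunc F) := cR.map π
  let gR : SkewVarIdx (2 * n) → MvPolynomial (SkewVarIdx (2 * n)) R := congrEntries cR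
  let tR : R := ⟨RatFunc.X ^ q, X_zpow_mem_regularSubring ha0 q⟩ * j α
  let ΔR : MvPolynomial (SkewVarIdx (2 * n)) R :=
    MvPolynomial.bind₁ gR (MvPolynomial.map (j.comp (algebraMap F (RatFunc F))) f) -
      MvPolynomial.C tR * MvPolynomial.map (j.comp (algebraMap F (RatFunc F))) (kPfaffMonomial F (2 * n) σ)
  -- `ΔR` is `Δ` (inclusion side)
  have h2 : R.subtype.comp (j.comp (algebraMap F (RatFunc F))) =
      (algebraMap (RatFunc F) (RatFunc (RatFunc F))).comp (algebraMap F (RatFunc F)) := rfl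
  have hsub : MvPolynomial.map R.subtype ΔR = Δ := by
    have h1 : (fun ij => MvPolynomial.map R.subtype (gR ij)) = congrEntries c := funext fun ij => by
      change MvPolynomial.map R.subtype (congrEntries cR ij) = _
      rw [map_congrEntries, hcR]
    have hG : MvPolynomial.map R.subtype
        (MvPolynomial.bind₁ gR (MvPolynomial.map (j.comp (algebraMap F (RatFunc F))) f)) =
        skewCongr c (MvPolynomial.map (algebraMap F (RatFunc F)) f) := by
      rw [MvPolynomial.map_bind₁, h1, MvPolynomial.map_map, h2, skewCongr_eq_bind₁,
        MvPolynomial.map_map]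
    have htR : R.subtype tR =
        RatFunc.X ^ q * algebraMap (RatFunc F) (RatFunc (RatFunc F)) α := by
      simp only [tR, map_mul]; rfl
    have hT : MvPolynomial.map R.subtype (MvPolynomial.C tR *
        MvPolynomial.map (j.comp (algebraMap F (RatFunc F))) (kPfaffMonomial F (2 * n) σ)) =
        MvPolynomial.C (RatFunc.X ^ q * algebraMap (RatFunc F) (RatFunc (RatFunc F)) α) *
          MvPolynomial.map (algebraMap (RatFunc F) (RatFunc (RatFunc F)))
            (kPfaffMonomial (RatFunc F) (2 * n) σ) := by
      rw [map_mul, MvPolynomial.map_C, htR, MvPolynomial.map_map, h2, ← MvPolynomial.map_map,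
        map_kPfaffMonomial]
    simp only [ΔR, Δ, map_sub, hG, hT]
  -- `ΔR` specialises to the new change of variables (evaluation side)
  have h2π : π.comp (j.comp (algebraMap F (RatFunc F))) = algebraMap F (RatFunc F) := by
    refine RingHom.ext fun x => ?_
    simp only [RingHom.comp_apply, hπj]
  have hπ : MvPolynomial.map π ΔR =
      skewCongr c' f -
        MvPolynomial.C (a ^ q * α) *
          MvPolynomial.map (algebraMap F (RatFunc F)) (kPfaffMonomial F (2 * n) σ) := by
    have h1 : (fun ij => MvPolynomial.map π (gR ij)) = congrEntries c' := funext fun ij => by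
      change MvPolynomial.map π (congrEntries cR ij) = _
      rw [map_congrEntries]
    have h3 : π tR = a ^ q * α := by
      change evalHom a (⟨RatFunc.X ^ q, X_zpow_mem_regularSubring ha0 q⟩ * j α) = _
      rw [map_mul, evalHom_X_zpow ha0 q]
      exact congrArg (a ^ q * ·) (hπj α)
    have hG : MvPolynomial.map π
        (MvPolynomial.bind₁ gR (MvPolynomial.map (j.comp (algebraMap F (RatFunc F))) f)) =
        skewCongr c' f := by
      rw [MvPolynomial.map_bind₁, h1, MvPolynomial.map_map, h2π, skewCongr_eq_bind₁]
    have hT : MvPolynomial.map π (MvPolynomial.C tR *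
        MvPolynomial.map (j.comp (algebraMap F (RatFunc F))) (kPfaffMonomial F (2 * n) σ)) =
        MvPolynomial.C (a ^ q * α) *
          MvPolynomial.map (algebraMap F (RatFunc F)) (kPfaffMonomial F (2 * n) σ) := by
      rw [map_mul, MvPolynomial.map_C, h3, MvPolynomial.map_map, h2π]
    simp only [ΔR, map_sub, hG, hT]
  -- ### Step D: the witnesses over `F`
  refine ⟨c', q * M + κ, α', σ, ?_, hα', hσr, hσb, fun e => ?_⟩
  · -- invertibility: `det c' = (det c)(ε, ε^M) ≠ 0`
    rw [Matrix.isUnit_iff_isUnit_det, isUnit_iff_ne_zero]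
    have hd : c'.det = π cR.det := by
      rw [RingHom.map_det, RingHom.mapMatrix_apply]
    have hd' : (cR.det : RatFunc (RatFunc F)) = c.det := by
      rw [← hcR, ← RingHom.mapMatrix_apply, ← RingHom.map_det]; rfl
    rw [hd]
    change RatFunc.eval (RingHom.id (RatFunc F)) a (cR.det : RatFunc (RatFunc F)) ≠ 0
    rw [hd']
    exact hMB
  · -- the `O(ε^{qM+κ+1})` estimate, coefficient by coefficient
    rw [isBigOEps_iff_v_le]
    have hX0 : (RatFunc.X : RatFunc F) ≠ 0 := RatFunc.X_ne_zero
    -- rewrite the target polynomial as `map π ΔR + C(a^q (α - ε^κ α')) · [K_σ]`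
    have htgt : skewCongr c' f -
        MvPolynomial.C (RatFunc.X ^ (q * M + κ) * algebraMap F (RatFunc F) α') *
          MvPolynomial.map (algebraMap F (RatFunc F)) (kPfaffMonomial F (2 * n) σ) =
        MvPolynomial.map π ΔR +
          MvPolynomial.C (a ^ q * (α - RatFunc.X ^ κ * algebraMap F (RatFunc F) α')) *
            MvPolynomial.map (algebraMap F (RatFunc F)) (kPfaffMonomial F (2 * n) σ) := by
      rw [hπ]
      have haq : a ^ q * (RatFunc.X ^ κ * algebraMap F (RatFunc F) α') =
          RatFunc.X ^ (q * M + κ) * algebraMap F (RatFunc F) α' := by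
        rw [← mul_assoc, hadef, ← zpow_natCast, ← zpow_mul, ← zpow_add₀ hX0, mul_comm (M : ℤ) q]
      rw [mul_sub, haq, map_sub MvPolynomial.C]
      ring
    rw [htgt, MvPolynomial.coeff_add, MvPolynomial.coeff_C_mul, MvPolynomial.coeff_map]
    -- the bound `exp (-(qM + κ + 1))`
    refine Valuation.map_add_le _ ?_ ?_
    · -- the specialised error term
      by_cases he : MvPolynomial.coeff e Δ = 0
      · have h'' : MvPolynomial.coeff e ΔR = 0 := by
          rw [← hsub, MvPolynomial.coeff_map] at he
          exact (map_eq_zero_iff R.subtype Subtype.val_injective).mp he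
        rw [h'', map_zero, Valuation.map_zero]; exact zero_le
      · have hes : e ∈ Δ.support := MvPolynomial.mem_support_iff.mpr he
        have hval : Valued.v (π (MvPolynomial.coeff e ΔR)) =
            gam (MvPolynomial.coeff e Δ) * exp (-(ordE (MvPolynomial.coeff e Δ) * M)) := by
          rw [← hMC e hes]
          change Valued.v (RatFunc.eval (RingHom.id (RatFunc F)) a ↑(MvPolynomial.coeff e ΔR)) = _
          rw [← hsub, MvPolynomial.coeff_map]; rfl
        have hord : q + 1 ≤ ordE (MvPolynomial.coeff e Δ) :=
          le_ordE_of_v_le he ((isBigOEps_iff_v_le _ _).mp (hbig e))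
        have hMge := hMD e hes
        rw [hval, ← exp_log (gam_ne_zero he), ← exp_add, exp_le_exp]
        have hM0 : (0 : ℤ) ≤ M := Int.natCast_nonneg M
        have hprod := mul_le_mul_of_nonneg_right hord hM0
        linarith
    · -- the main term `ε^{Mq} (α - ε^κ α') ([K_σ])_e`
      rw [map_mul, map_mul]
      have h1 : Valued.v (a ^ q) = exp (-(q * M)) := by
        rw [hadef, ← zpow_natCast, ← zpow_mul, v_X_zpow, mul_comm]
      have h3 : Valued.v (algebraMap F (RatFunc F) (MvPolynomial.coeff e (kPfaffMonomial F (2 * n) σ))) ≤ 1 := by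
        rw [RatFunc.algebraMap_eq_C]; exact v_C_le_one _
      calc Valued.v (a ^ q) * Valued.v (α - RatFunc.X ^ κ * algebraMap F (RatFunc F) α') *
            Valued.v (algebraMap F (RatFunc F) (MvPolynomial.coeff e (kPfaffMonomial F (2 * n) σ)))
          ≤ exp (-(q * M)) * exp (-(κ + 1)) * 1 := by
            rw [h1]
            exact mul_le_mul' (mul_le_mul' le_rfl hαv) h3
        _ = exp (-(q * ↑M + κ + 1)) := by rw [mul_one, ← exp_add]; congr 1; ring

/-! ### Theorem 4.4: the discharges -/

/-- **Discharge of `AndrewsForbes2022_thm_4_4`** (AF22 Thm. 4.4, characteristic zero): the tree's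
reduction `AndrewsForbes2022_thm_4_4_of_prop_4_2` fed with `AndrewsForbes2022_prop_4_2_holds`.
[cite: AndrewsForbes2022, Thm. 4.4] -/
theorem AndrewsForbes2022_thm_4_4_holds : AndrewsForbes2022_thm_4_4 :=
  AndrewsForbes2022_thm_4_4_of_prop_4_2 AndrewsForbes2022_prop_4_2_holds

/-- **Discharge of `AndrewsForbes2022_thm_4_4_posChar`** (AF22 Thm. 4.4, positive-characteristic
bullet, every field of characteristic `p > 0`, finite fields included): the tree's reduction
`AndrewsForbes2022_thm_4_4_posChar_of` fed with Prop. 4.2 over every field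
(`AndrewsForbes2022_prop_4_2_of_field`). [cite: AndrewsForbes2022, Thm. 4.4 (third bullet)] -/
theorem AndrewsForbes2022_thm_4_4_posChar_holds : AndrewsForbes2022_thm_4_4_posChar :=
  AndrewsForbes2022_thm_4_4_posChar_of fun _ _ F _ _ n r hr hrn f hf hf0 =>
    AndrewsForbes2022_prop_4_2_of_field F n r hr hrn f hf hf0

open MvPolynomial AndrewsForbes in
/-- **Cor. 4.5 reduced to its last printed input.** With Thm. 4.4 discharged, AF22 Cor. 4.5
(`AndrewsForbes2022_cor_4_5`, characteristic zero, p0028:L63) follows from ONE remaining published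
ingredient, taken here as a hypothesis and NOT yet in the tree: a layered ABP with `c·t³` vertices
computing `Pf(X)` for the generic skew-symmetric `2t × 2t` matrix, `t ≥ 1`, over fields of
characteristic zero ([MSV04, Thm. 12] as cited in the printed proof, p0028:L74).  (`t = 0` is the
trivial circuit, as in `AndrewsForbes2022_cor_4_5_of'`.) [cite: AndrewsForbes2022, Cor. 4.5 (proof)] -/
theorem AndrewsForbes2022_cor_4_5_of_pfaffianABP {c : ℕ}
    (hpf : ∀ (F : Type) [Field F] [CharZero F] (t : ℕ), 1 ≤ t →
      LayeredABPComputes (c * t ^ 3) (pfaffian (2 * t) (skewX F (2 * t)))) :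
    AndrewsForbes2022_cor_4_5 := by
  refine ⟨c, fun F _ _ n r f hf hf0 h hh t ht => ?_⟩
  rcases Nat.eq_zero_or_pos t with rfl | htpos
  · have h1 : pfaffian (2 * 0) (skewX F (2 * 0)) = 1 := rfl
    refine ⟨0, fun _ => 0, 0, 1, fun _ => by rw [totalDegree_zero]; exact Nat.zero_le _, ?_⟩
    simp only [h1, map_one, map_zero, zero_mul, zero_add, sub_self]
    exact PolyOrdGE.zero 1
  · exact AndrewsForbes2022_thm_4_4_holds F n r f hf hf0 h hh _ _
      (InLayeredABPBorder.of_computes ((hpf F t htpos).mono ht))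

end Literature.Computability.AlgebraicComplexity
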